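import Literature.Barriers.CriticalPhenomena.PlanarEdwardsModelDiffusiveSILTBlocks
import Mathlib.Probability.Distributions.Gaussian.IsGaussianProcess.Independence
import Mathlib.Probability.Distributions.Gaussian.IsGaussianProcess.Basic
import Mathlib.Probability.Distributions.Gaussian.HasGaussianLaw.Independence
import Mathlib.Probability.Moments.Covariance
import Mathlib.Analysis.Complex.Basic
import Mathlib.Analysis.InnerProductSpace.Basic
import Mathlib.Topology.Algebra.Module.FiniteDimension
import HarnessLib

/-!
# Mollified self-intersection local time of planar Brownian motion: independence of the block
# functionals over disjoint time intervals (Le Gall 1994, fact (i))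

Sibling file of `Literature.Barriers.CriticalPhenomena.PlanarEdwardsModelDiffusive`, towards the
negative exponential moments `Edwards2D.Varadhan1969_negExpMoments` (Le Gall 1994, (2) and
Remark (a), p. 178). Le Gall's fact (i) after (5): for fixed `n`, the intersection local times
`α(Aⁿ_1), …, α(Aⁿ_{2^{n-1}})` of the dyadic off-diagonal squares
`Aⁿ_k = [(2k-2)2⁻ⁿ, (2k-1)2⁻ⁿ] × [(2k-1)2⁻ⁿ, 2k 2⁻ⁿ]` are independent, because `α(Aⁿ_k)` is a
functional of the increments of the Brownian motion over the time interval
`[(2k-2)2⁻ⁿ, 2k2⁻ⁿ]` and these intervals are disjoint. We prove the mollified version, for the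
block functionals `B_k(R) = ∫_R g_k(Z_t - Z_s) ds dt` (`Edwards2D.blockSILT`) of a planar Brownian
motion `Z` and ANY side length `θ > 0`:

* `Edwards2D.isGaussianProcess_complex`: a planar Brownian motion
  (`Literature.Probability.Process.IsBrownianComplex`: independent real Brownian coordinates) is a
  Gaussian process (`ℂ` as a real Hilbert space);
* `Edwards2D.blkIncr Z θ i u = Z_{(u ∨ 2iθ) ∧ (2iθ+2θ)} - Z_{2iθ}`, the increment process of the
  `i`-th interval `[2iθ, 2iθ + 2θ]`, jointly Gaussian in `(i, u)` (`isGaussianProcess_blkIncr`), with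
  vanishing cross-covariances between different intervals (`covariance_inner_blkIncr_eq_zero`:
  `Cov(B_t - B_s, B_v - B_u) = t∧v - t∧u - s∧v + s∧u = 0` for `s ≤ t ≤ u ≤ v`, and independence of
  the two coordinates), hence **independent as path-valued random variables**
  (`iIndepFun_blkIncr`, Mathlib's `IsGaussianProcess.iIndepFun_of_covariance_inner`);
* the block functional over a rectangle inside `[2iθ, 2iθ+2θ]²` is a measurable functional of the
  `i`-th increment path (`blockSILT_blkIncr`, `measurable_comap_blockSILT_blkIncr`), hence
  **`(B_k([2iθ, 2iθ+θ] × [2iθ+θ, 2iθ+2θ]))_{i ∈ ℕ}` is an independent family**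
  (`iIndepFun_blockSILT_offDiag`).

## References

* J.-F. Le Gall, *Exponential moments for the renormalized self-intersection local time of planar
  Brownian motion*, Sém. Prob. XXVIII, LNM 1583 (1994), 172–180: p. 173, fact (i).
-/

noncomputable section

open MeasureTheory ProbabilityTheory Real Filter Set Function
open scoped NNReal ENNReal Topology

namespace Literature.Barriers.CriticalPhenomena

namespace Edwards2D

open Literature.Probability.Process

universe u

variable {Ω : Type u} {Z : ℝ≥0 → Ω → ℂ}

/-! ### Planar Brownian motion is a Gaussian process -/

/-- The `ℝ`-linear map gluing a real and an imaginary coordinate vector into a complex vector,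
`(x, y) ↦ (i ↦ x_i + y_i √-1)`. [folklore] -/
def reImGlue (ι : Type*) [Fintype ι] : ((ι → ℝ) × (ι → ℝ)) →L[ℝ] (ι → ℂ) :=
  LinearMap.toContinuousLinearMap
    { toFun := fun xy i => ((xy.1 i : ℝ) : ℂ) + ((xy.2 i : ℝ) : ℂ) * Complex.I
      map_add' := fun x y => by
        funext i
        simp only [Prod.fst_add, Prod.snd_add, Pi.add_apply, Complex.ofReal_add]
        ring
      map_smul' := fun c x => by
        funext i
        simp only [Prod.smul_fst, Prod.smul_snd, Pi.smul_apply, smul_eq_mul, Complex.ofReal_mul,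
          RingHom.id_apply, Complex.real_smul]
        ring }

/-- `reImGlue` evaluated: `reImGlue ι (x, y) i = x_i + y_i √-1`. [folklore] -/
theorem reImGlue_apply {ι : Type*} [Fintype ι] (xy : (ι → ℝ) × (ι → ℝ)) (i : ι) :
    reImGlue ι xy i = ((xy.1 i : ℝ) : ℂ) + ((xy.2 i : ℝ) : ℂ) * Complex.I := rfl

section GP

variable [MeasurableSpace Ω] {P : Measure Ω}

/-- **A planar Brownian motion is a Gaussian process** (values in `ℂ` viewed as a real Banach
space): its finite-dimensional marginals are the images under the real-linear gluing map of the
pair of marginals of the two coordinates, which are independent Gaussian vectors, hence jointly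
Gaussian (Mathlib's `IndepFun.hasGaussianLaw`). [folklore] -/
theorem isGaussianProcess_complex (hZ : IsBrownianComplex Z P) : IsGaussianProcess Z P where
  hasGaussianLaw I := by
    have hre : HasGaussianLaw (fun ω => I.restrict fun t => (Z t ω).re) P :=
      hZ.re.toIsPreBrownianReal.isGaussianProcess.hasGaussianLaw I
    have him : HasGaussianLaw (fun ω => I.restrict fun t => (Z t ω).im) P :=
      hZ.im.toIsPreBrownianReal.isGaussianProcess.hasGaussianLaw I
    have hind : IndepFun (fun ω => I.restrict fun t => (Z t ω).re)
        (fun ω => I.restrict fun t => (Z t ω).im) P :=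
      hZ.indepFun.comp (Finset.measurable_restrict I) (Finset.measurable_restrict I)
    have hpair := hind.hasGaussianLaw hre him
    have h := hpair.map (reImGlue I)
    have hfun : (⇑(reImGlue I) ∘ fun ω => (I.restrict fun t => (Z t ω).re, I.restrict fun t => (Z t ω).im)) =
        fun ω => I.restrict (Z · ω) := by
      funext ω
      funext i
      simp only [comp_apply, reImGlue_apply, Finset.restrict, Complex.re_add_im]
    rw [hfun] at h
    exact h

end GP

/-! ### The increment processes of the time intervals `[2iθ, 2iθ + 2θ]` -/

/-- Left end point `2iθ` of the `i`-th interval (clamped to `ℝ≥0`). [cite: LeGall1994, p. 173, (4)] -/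
def blkBase (θ : ℝ) (i : ℕ) : ℝ≥0 := (2 * i * θ).toNNReal

/-- Right end point `2iθ + 2θ` of the `i`-th interval (clamped to `ℝ≥0`). [cite: LeGall1994, p. 173, (4)] -/
def blkTop (θ : ℝ) (i : ℕ) : ℝ≥0 := (2 * i * θ + 2 * θ).toNNReal

/-- Projection of a time onto the `i`-th interval `[2iθ, 2iθ + 2θ]`. [folklore] -/
def blkClamp (θ : ℝ) (i : ℕ) (u : ℝ≥0) : ℝ≥0 := max (blkBase θ i) (min u (blkTop θ i))

/-- **The increment process of the `i`-th interval**: `u ↦ Z_{clamp_i u} - Z_{2iθ}` (constant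
outside `[2iθ, 2iθ+2θ]`, a functional of the increments of `Z` over that interval only).
[cite: LeGall1994, p. 173, fact (i)] -/
def blkIncr (Z : ℝ≥0 → Ω → ℂ) (θ : ℝ) (i : ℕ) (u : ℝ≥0) (ω : Ω) : ℂ :=
  Z (blkClamp θ i u) ω - Z (blkBase θ i) ω

/-- `2iθ ≤ clamp_i u`. [folklore] -/
theorem blkBase_le_blkClamp (θ : ℝ) (i : ℕ) (u : ℝ≥0) : blkBase θ i ≤ blkClamp θ i u :=
  le_max_left _ _

/-- `clamp_i u ≤ 2iθ + 2θ` (for `θ ≥ 0`). [folklore] -/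
theorem blkClamp_le_blkTop {θ : ℝ} (hθ : 0 ≤ θ) (i : ℕ) (u : ℝ≥0) : blkClamp θ i u ≤ blkTop θ i := by
  refine max_le ?_ (min_le_right _ _)
  unfold blkBase blkTop
  exact Real.toNNReal_le_toNNReal (by linarith)

/-- Consecutive intervals only touch: `2iθ + 2θ ≤ 2jθ` for `i < j` (and `θ ≥ 0`). [folklore] -/
theorem blkTop_le_blkBase {θ : ℝ} (hθ : 0 ≤ θ) {i j : ℕ} (hij : i < j) : blkTop θ i ≤ blkBase θ j := by
  unfold blkBase blkTop
  refine Real.toNNReal_le_toNNReal ?_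
  have h : (i : ℝ) + 1 ≤ j := by exact_mod_cast hij
  nlinarith

/-- The projection is the identity on the interval (real times, clamped by `Real.toNNReal` as in
`Edwards2D.kernelProc`). [folklore] -/
theorem blkClamp_toNNReal {θ : ℝ} {i : ℕ} {s : ℝ} (h1 : 2 * i * θ ≤ s) (h2 : s ≤ 2 * i * θ + 2 * θ) :
    blkClamp θ i s.toNNReal = s.toNNReal := by
  unfold blkClamp blkBase blkTop
  rw [min_eq_left (Real.toNNReal_le_toNNReal h2), max_eq_right (Real.toNNReal_le_toNNReal h1)]

/-- The projection is continuous. [folklore] -/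
theorem continuous_blkClamp (θ : ℝ) (i : ℕ) : Continuous (blkClamp θ i) :=
  continuous_const.max (continuous_id.min continuous_const)

/-- The increment process has continuous paths. [folklore] -/
theorem continuous_blkIncr (hcont : ∀ ω, Continuous (Z · ω)) (θ : ℝ) (i : ℕ) (ω : Ω) :
    Continuous fun u => blkIncr Z θ i u ω :=
  ((hcont ω).comp (continuous_blkClamp θ i)).sub continuous_const

section Meas

variable [MeasurableSpace Ω] {P : Measure Ω}

/-- The increment process has measurable marginals. [folklore] -/
theorem measurable_blkIncr (hmeas : ∀ t, Measurable (Z t)) (θ : ℝ) (i : ℕ) (u : ℝ≥0) :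
    Measurable (blkIncr Z θ i u) :=
  (hmeas _).sub (hmeas _)

/-- **The increment processes are jointly Gaussian** in `(i, u)` (finite linear combinations of
values of the Gaussian process `Z`). [folklore] -/
theorem isGaussianProcess_blkIncr (hZ : IsBrownianComplex Z P) (θ : ℝ) :
    IsGaussianProcess (fun (p : (_ : ℕ) × ℝ≥0) ω => blkIncr Z θ p.1 p.2 ω) P := by
  classical
  refine (isGaussianProcess_complex hZ).of_isGaussianProcess fun p => ?_
  refine ⟨{blkClamp θ p.1 p.2, blkBase θ p.1},
    { toFun := fun x => x ⟨blkClamp θ p.1 p.2, by simp⟩ - x ⟨blkBase θ p.1, by simp⟩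
      map_add' := fun x y => by simp only [Pi.add_apply]; abel
      map_smul' := fun c x => by simp only [Pi.smul_apply, RingHom.id_apply, smul_sub] },
    fun ω => ?_⟩
  simp [blkIncr]

end Meas

/-! ### Vanishing cross-covariances -/

/-- The real inner product on `ℂ` in coordinates: `⟪x, w⟫ = Re w · Re x + Im w · Im x`. [folklore] -/
theorem real_inner_complex_eq (x w : ℂ) : inner ℝ x w = w.re * x.re + w.im * x.im := by
  rw [Complex.inner, Complex.mul_re, Complex.conj_re, Complex.conj_im]
  ring

section Cov

variable [MeasurableSpace Ω] {P : Measure Ω}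

/-- Bilinearity: if the four cross-covariances of `A, B` with `C, D` vanish then so does the
covariance of any two linear combinations. [folklore] -/
theorem covariance_lincomb_eq_zero [IsProbabilityMeasure P] {A B C D : Ω → ℝ} (hA : MemLp A 2 P)
    (hB : MemLp B 2 P) (hC : MemLp C 2 P) (hD : MemLp D 2 P) (h1 : cov[A, C; P] = 0)
    (h2 : cov[A, D; P] = 0) (h3 : cov[B, C; P] = 0) (h4 : cov[B, D; P] = 0) (a b c d : ℝ) :
    cov[fun ω => A ω * a + B ω * b, fun ω => C ω * c + D ω * d; P] = 0 := by
  have eL : (fun ω => A ω * a + B ω * b) = (fun ω => A ω * a) + fun ω => B ω * b := rfl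
  have eR : (fun ω => C ω * c + D ω * d) = (fun ω => C ω * c) + fun ω => D ω * d := rfl
  rw [eL, eR, covariance_add_left (hA.mul_const a) (hB.mul_const b) ((hC.mul_const c).add (hD.mul_const d)),
    covariance_add_right (hA.mul_const a) (hC.mul_const c) (hD.mul_const d),
    covariance_add_right (hB.mul_const b) (hC.mul_const c) (hD.mul_const d)]
  simp only [covariance_mul_const_left, covariance_mul_const_right, h1, h2, h3, h4]
  ring

/-- `t∧v - t∧u - s∧v + s∧u = 0` for `s ≤ t ≤ u ≤ v` (increments over disjoint intervals are
uncorrelated). [folklore] -/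
theorem incrCov_eq_zero_of_le {s t u v : ℝ} (hst : s ≤ t) (htu : t ≤ u) (huv : u ≤ v) :
    incrCov s t u v = 0 := by
  unfold incrCov
  rw [min_eq_left (htu.trans huv), min_eq_left htu, min_eq_left (hst.trans (htu.trans huv)),
    min_eq_left (hst.trans htu)]
  ring

/-- A real Brownian coordinate: increments over `[s,t]` and `[u,v]` with `s ≤ t ≤ u ≤ v` are
uncorrelated (`IsPreBrownianReal.covariance_increments`). [folklore] -/
theorem covariance_increments_eq_zero {B : ℝ≥0 → Ω → ℝ} (hB : IsPreBrownianReal B P) {s t u v : ℝ≥0}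
    (hst : s ≤ t) (htu : t ≤ u) (huv : u ≤ v) :
    cov[fun ω => B t ω - B s ω, fun ω => B v ω - B u ω; P] = 0 := by
  rw [hB.covariance_increments]
  exact incrCov_eq_zero_of_le (by exact_mod_cast hst) (by exact_mod_cast htu) (by exact_mod_cast huv)

/-- Increments of the two (independent) coordinates of a planar Brownian motion are uncorrelated.
[folklore] -/
theorem covariance_re_im_increments_eq_zero (hZ : IsBrownianComplex Z P) (s t u v : ℝ≥0) :
    cov[fun ω => (Z t ω).re - (Z s ω).re, fun ω => (Z v ω).im - (Z u ω).im; P] = 0 := by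
  have hind : IndepFun (fun ω => (Z t ω).re - (Z s ω).re) (fun ω => (Z v ω).im - (Z u ω).im) P :=
    hZ.indepFun.comp (φ := fun f : ℝ≥0 → ℝ => f t - f s) (ψ := fun f : ℝ≥0 → ℝ => f v - f u)
      ((measurable_pi_apply t).sub (measurable_pi_apply s))
      ((measurable_pi_apply v).sub (measurable_pi_apply u))
  refine hind.covariance_eq_zero ?_ ?_
  · exact (hZ.re.toIsPreBrownianReal.isGaussianProcess.hasGaussianLaw_eval t).memLp_two.sub
      (hZ.re.toIsPreBrownianReal.isGaussianProcess.hasGaussianLaw_eval s).memLp_two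
  · exact (hZ.im.toIsPreBrownianReal.isGaussianProcess.hasGaussianLaw_eval v).memLp_two.sub
      (hZ.im.toIsPreBrownianReal.isGaussianProcess.hasGaussianLaw_eval u).memLp_two

/-- **Vanishing cross-covariances of the increment processes of two different intervals**, for
the ordered pair `i < j`. [cite: LeGall1994, p. 173, fact (i)] -/
theorem covariance_inner_blkIncr_eq_zero_of_lt [IsProbabilityMeasure P] (hZ : IsBrownianComplex Z P) {θ : ℝ} (hθ : 0 ≤ θ)
    {i j : ℕ} (hij : i < j) (u v : ℝ≥0) (x y : ℂ) :
    cov[fun ω => inner ℝ x (blkIncr Z θ i u ω), fun ω => inner ℝ y (blkIncr Z θ j v ω); P] = 0 := by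
  simp only [real_inner_complex_eq, blkIncr, Complex.sub_re, Complex.sub_im]
  -- the order of the four times
  have h1 : blkBase θ i ≤ blkClamp θ i u := blkBase_le_blkClamp θ i u
  have h2 : blkClamp θ i u ≤ blkBase θ j := (blkClamp_le_blkTop hθ i u).trans (blkTop_le_blkBase hθ hij)
  have h3 : blkBase θ j ≤ blkClamp θ j v := blkBase_le_blkClamp θ j v
  have hre := hZ.re.toIsPreBrownianReal
  have him := hZ.im.toIsPreBrownianReal
  have mre : ∀ r : ℝ≥0, MemLp (fun ω => (Z r ω).re) 2 P :=
    fun r => (hre.isGaussianProcess.hasGaussianLaw_eval r).memLp_two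
  have mim : ∀ r : ℝ≥0, MemLp (fun ω => (Z r ω).im) 2 P :=
    fun r => (him.isGaussianProcess.hasGaussianLaw_eval r).memLp_two
  refine covariance_lincomb_eq_zero ((mre _).sub (mre _)) ((mim _).sub (mim _)) ((mre _).sub (mre _))
    ((mim _).sub (mim _)) ?_ ?_ ?_ ?_ _ _ _ _
  · exact covariance_increments_eq_zero hre h1 h2 h3
  · exact covariance_re_im_increments_eq_zero hZ _ _ _ _
  · rw [covariance_comm]
    exact covariance_re_im_increments_eq_zero hZ _ _ _ _
  · exact covariance_increments_eq_zero him h1 h2 h3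

/-- **Vanishing cross-covariances of the increment processes of two different intervals.**
[cite: LeGall1994, p. 173, fact (i)] -/
theorem covariance_inner_blkIncr_eq_zero [IsProbabilityMeasure P] (hZ : IsBrownianComplex Z P) {θ : ℝ} (hθ : 0 ≤ θ)
    {i j : ℕ} (hij : i ≠ j) (u v : ℝ≥0) (x y : ℂ) :
    cov[fun ω => inner ℝ x (blkIncr Z θ i u ω), fun ω => inner ℝ y (blkIncr Z θ j v ω); P] = 0 := by
  rcases lt_or_gt_of_ne hij with h | h
  · exact covariance_inner_blkIncr_eq_zero_of_lt hZ hθ h u v x y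
  · rw [covariance_comm]
    exact covariance_inner_blkIncr_eq_zero_of_lt hZ hθ h v u y x

/-- **The increment processes of the intervals `[2iθ, 2iθ+2θ]`, `i ∈ ℕ`, are independent** as
path-valued random variables (jointly Gaussian and uncorrelated: Mathlib's
`IsGaussianProcess.iIndepFun_of_covariance_inner`). [cite: LeGall1994, p. 173, fact (i)] -/
theorem iIndepFun_blkIncr [IsProbabilityMeasure P] (hZ : IsBrownianComplex Z P) (hmeas : ∀ t, Measurable (Z t)) {θ : ℝ}
    (hθ : 0 ≤ θ) : iIndepFun (fun i ω u => blkIncr Z θ i u ω) P :=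
  (isGaussianProcess_blkIncr hZ θ).iIndepFun_of_covariance_inner (S := fun _ => ℝ≥0)
    (X := fun i u ω => blkIncr Z θ i u ω) (fun i u => (measurable_blkIncr hmeas θ i u).aemeasurable)
    fun _ _ hij u v x y => covariance_inner_blkIncr_eq_zero hZ hθ hij u v x y

end Cov

/-! ### The block functionals are functionals of the increment paths -/

/-- On a rectangle inside `[2iθ, 2iθ+2θ]²` the block functional of `Z` equals the block functional
of the `i`-th increment process (the base point cancels in `Z_t - Z_s`). [folklore] -/
theorem blockSILT_blkIncr {θ : ℝ} {i : ℕ} (k : ℕ) {a b c d : ℝ} (ha : 2 * i * θ ≤ a)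
    (hb : b ≤ 2 * i * θ + 2 * θ) (hc : 2 * i * θ ≤ c) (hd : d ≤ 2 * i * θ + 2 * θ) (ω : Ω) :
    blockSILT (blkIncr Z θ i) k a b c d ω = blockSILT Z k a b c d ω := by
  unfold blockSILT
  rw [rect, Measure.prod_restrict]
  refine setIntegral_congr_fun (measurableSet_Icc.prod measurableSet_Icc) fun p hp => ?_
  rw [Set.mem_prod] at hp
  simp only [kernelProc, blkIncr]
  rw [blkClamp_toNNReal (ha.trans hp.1.1) (hp.1.2.trans hb),
    blkClamp_toNNReal (hc.trans hp.2.1) (hp.2.2.trans hd), sub_sub_sub_cancel_right]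

/-- The block functional of the `i`-th increment process is measurable with respect to the
σ-algebra generated by the `i`-th increment path. [folklore] -/
theorem measurable_comap_blockSILT_blkIncr (hcont : ∀ ω, Continuous (Z · ω)) (θ : ℝ) (i k : ℕ)
    (a b c d : ℝ) :
    Measurable[MeasurableSpace.comap (fun ω u => blkIncr Z θ i u ω) MeasurableSpace.pi]
      (blockSILT (blkIncr Z θ i) k a b c d) := by
  set m : MeasurableSpace Ω := MeasurableSpace.comap (fun ω u => blkIncr Z θ i u ω) MeasurableSpace.pi
    with hm
  have hpath : Measurable[m] (fun ω u => blkIncr Z θ i u ω) := Measurable.of_comap_le le_rfl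
  have h1 : ∀ u, Measurable[m] (blkIncr Z θ i u) := fun u =>
    (measurable_pi_apply (X := fun _ : ℝ≥0 => ℂ) u).comp hpath
  exact @measurable_blockSILT Ω (blkIncr Z θ i) m h1 (continuous_blkIncr hcont θ i) k a b c d

section Indep

variable [MeasurableSpace Ω] {P : Measure Ω}

/-- **Independence of the off-diagonal block functionals within one level** (the mollified form of
Le Gall's fact (i)): for every side length `θ > 0` and every `k`, the block functionals
`B_k([2iθ, 2iθ+θ] × [2iθ+θ, 2iθ+2θ])`, `i ∈ ℕ`, of a planar Brownian motion are independent.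
[cite: LeGall1994, p. 173, fact (i)] -/
theorem iIndepFun_blockSILT_offDiag [IsProbabilityMeasure P] (hZ : IsBrownianComplex Z P)
    (hmeas : ∀ t, Measurable (Z t)) (hcont : ∀ ω, Continuous (Z · ω)) {θ : ℝ} (hθ : 0 < θ) (k : ℕ) :
    iIndepFun (fun i : ℕ => blockSILT Z k (2 * i * θ) (2 * i * θ + θ) (2 * i * θ + θ) (2 * i * θ + 2 * θ)) P := by
  have hind := iIndepFun_blkIncr hZ hmeas hθ.le
  rw [iIndepFun_iff_iIndep] at hind ⊢
  refine iIndep_of_iIndep_of_le hind fun i => ?_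
  have hfun : blockSILT Z k (2 * i * θ) (2 * i * θ + θ) (2 * i * θ + θ) (2 * i * θ + 2 * θ) =
      blockSILT (blkIncr Z θ i) k (2 * i * θ) (2 * i * θ + θ) (2 * i * θ + θ) (2 * i * θ + 2 * θ) := by
    funext ω
    exact (blockSILT_blkIncr k le_rfl (by linarith) (by linarith) le_rfl ω).symm
  rw [hfun]
  exact (measurable_comap_blockSILT_blkIncr hcont θ i k _ _ _ _).comap_le

end Indep

end Edwards2D

end Literature.Barriers.CriticalPhenomena
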